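import Literature.Geometry.Lorentzian.KerrSchildMultiplierCurrent
import Literature.Geometry.Lorentzian.MinkowskiRadialMultiplier

/-! # Route ClusterCompleteness — crux `AdiabaticMultiKerrILED`: cone coercivity of the homothety energy density

Helper file for the crux `stmt-FinalStateConjecture-14310` (line `Sketch`, lead c6 wave 1, card
milne-hubble-current): the time component of the current of the homothety multiplier
`S = (x − x₀)·∂` on Minkowski space (`G = η = diag(−1,1,1,1)`, `X^α(y) = y^α − x₀^α`) is minus the
energy density of the scaling energy on the slices `{x⁰ = t}`. With `p_μ = ∂_μ w(x)`,
`T = x⁰ − x₀⁰`, `d_i = x^i − x₀^i`, one has `−(J^S)⁰ = ½ T ∑_μ p_μ² + p₀ (d⃗·p⃗)`, and by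
Cauchy–Schwarz `|d⃗·p⃗| ≤ |d⃗| |p⃗|` and `|p₀| |p⃗| ≤ ½ (p₀² + |p⃗|²)` this dominates
`½ (T − |d⃗|) ∑_μ p_μ²` at every point (inside the cone `{T > |d⃗|}` this is coercivity).
[folklore] -/

noncomputable section

-- the doubled `FinalStateConjecture.FinalStateConjecture` path component trips dupNamespace
set_option linter.dupNamespace false

open scoped BigOperators
open Literature.Geometry.Lorentzian

namespace Summit.FinalStateConjecture.FinalStateConjecture.Theorems

/-- The scalar core of the cone coercivity: if `c² ≤ D² q` with `D ≥ 0` (Cauchy–Schwarz for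
`c = d⃗·p⃗`, `D = |d⃗|`, `q = |p⃗|²`), then `−p₀ c ≤ ½ D (p₀² + q)`
(for `D > 0`: `D (½ D (p₀² + q) + p₀ c) ≥ ½ (D p₀ + c)² + ½ (D² q − c²) ≥ 0`). [folklore] -/
private theorem homothetyFlux_scalar {D c P₀ q : ℝ} (hD : 0 ≤ D) (hCS : c ^ 2 ≤ D ^ 2 * q) :
    -(P₀ * c) ≤ 2⁻¹ * D * (P₀ ^ 2 + q) := by
  rcases hD.eq_or_lt with hD0 | hDpos
  · subst hD0
    have hc2 : c ^ 2 = 0 := le_antisymm (by simpa using hCS) (sq_nonneg c)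
    have hc : c = 0 := pow_eq_zero_iff two_ne_zero |>.mp hc2
    simp [hc]
  · refine le_of_mul_le_mul_left ?_ hDpos
    nlinarith [sq_nonneg (D * P₀ + c), hCS]

/-- **Cone coercivity of the homothety energy density on Minkowski space.** For the constant
coefficients `η = diag(−1,1,1,1)` and the homothety multiplier `X^α(y) = y^α − x₀^α` centred at
`x₀`, the time component of the multiplier current satisfies, at every point `x` and for every
`w`, `½ ((x⁰ − x₀⁰) − |x⃗ − x⃗₀|) ∑_μ (∂_μ w)² ≤ −(J^X)⁰(x)`
(`−(J^X)⁰ = ½ (x⁰ − x₀⁰) ∑_μ (∂_μw)² + ∂₀w ∑_i (x^i − x₀^i) ∂_iw`, Cauchy–Schwarz and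
`2|∂₀w| |∇⃗w| ≤ ∑_μ (∂_μw)²`). [folklore] -/
theorem homothetyFlux_coercive :
    ∀ (x₀ : E4) (w : E4 → ℝ) (x : E4), 2⁻¹ * ((x 0 - x₀ 0) - ‖E4.spatial x - E4.spatial x₀‖) *
        ∑ μ, fderiv ℝ w x (E4.basisVector μ) ^ 2 ≤
      -KerrSchild.multiplierCurrent (fun _ ↦ Kerr.etaComp) (fun y α ↦ y α - x₀ α) w x 0 := by
  intro x₀ w x
  -- name the atoms
  obtain ⟨P, hP⟩ : ∃ P : Fin 4 → ℝ, ∀ κ, fderiv ℝ w x (E4.basisVector κ) = P κ := ⟨_, fun _ ↦ rfl⟩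
  -- the spatial distance squared in coordinates
  have hD2 : ‖E4.spatial x - E4.spatial x₀‖ ^ 2 =
      (x 1 - x₀ 1) ^ 2 + (x 2 - x₀ 2) ^ 2 + (x 3 - x₀ 3) ^ 2 := by
    rw [← map_sub]
    have h := E4.spatialNorm_sq (x - x₀)
    simpa [E4.spatialNorm] using h
  -- Cauchy–Schwarz in `ℝ³` (Lagrange's identity)
  have hCS : ((x 1 - x₀ 1) * P 1 + (x 2 - x₀ 2) * P 2 + (x 3 - x₀ 3) * P 3) ^ 2 ≤
      ‖E4.spatial x - E4.spatial x₀‖ ^ 2 * (P 1 ^ 2 + P 2 ^ 2 + P 3 ^ 2) := by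
    rw [hD2]
    nlinarith [sq_nonneg ((x 1 - x₀ 1) * P 2 - (x 2 - x₀ 2) * P 1),
      sq_nonneg ((x 1 - x₀ 1) * P 3 - (x 3 - x₀ 3) * P 1),
      sq_nonneg ((x 2 - x₀ 2) * P 3 - (x 3 - x₀ 3) * P 2)]
  have key := homothetyFlux_scalar (P₀ := P 0) (norm_nonneg (E4.spatial x - E4.spatial x₀)) hCS
  -- expand the current
  simp only [KerrSchild.multiplierCurrent, hP, KerrSchild.etaComp_eq, Fin.sum_univ_four, Fin.isValue]
  simp only [show (1 : Fin 4) ≠ 0 from by decide, show (2 : Fin 4) ≠ 0 from by decide,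
    show (3 : Fin 4) ≠ 0 from by decide, show (0 : Fin 4) ≠ 1 from by decide,
    show (0 : Fin 4) ≠ 2 from by decide, show (0 : Fin 4) ≠ 3 from by decide,
    show (1 : Fin 4) ≠ 2 from by decide, show (1 : Fin 4) ≠ 3 from by decide,
    show (2 : Fin 4) ≠ 1 from by decide, show (2 : Fin 4) ≠ 3 from by decide,
    show (3 : Fin 4) ≠ 1 from by decide, show (3 : Fin 4) ≠ 2 from by decide, if_true, if_false]
  nlinarith [key]

end Summit.FinalStateConjecture.FinalStateConjecture.Theorems
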